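import Literature.AlgebraicGeometry.Motives.MixedHodgeExtensionWeakMotifNonSeparated
import Literature.AlgebraicGeometry.Motives.MixedHodgeExtensionSubQuotient
import HarnessLib

/-!
# Dévissage of `Ext(ℚ(-p), B) = J⁰_W(B(p))` along `0 → W_{2p-1}B → B → B/W_{2p-1}B → 0`

Jannsen, *Mixed Motives and Algebraic K-Theory* (LNM 1400), §9, proof of LEMMA 9.2: the group
`Ext¹_MH(ℤ, H) = J(H) = W₀H_ℂ/(W₀H + F⁰W₀H_ℂ)` is analysed through the weight filtration
("(9.2.3) `Ext¹(ℤ, H) → Ext¹(ℤ, W₀H) → J(W₀H) = J(H)` … `Hom_MH(ℤ, H/W₀H) = 0 = Ext¹_MH(ℤ, H/W₀H)`");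
Carlson, §2(b): the separated extensions are "those which arise naturally from a fixed mixed Hodge
structure: `0 → W_ℓ → H → H/W_ℓ → 0`", and for them `Ext` is the generalized intermediate Jacobian.

For an ARBITRARY mixed `ℚ`-Hodge structure `B` the group `J⁰_W(B(p)) = Ext(ℚ(-p), B)` (twisted by
`p`; the tree's `Ext.tateEquivJacobianW`) mixes two pieces of different nature: the generalized
intermediate Jacobian `J^p(W_{2p-1}B)_ℚ` of the part of weights `< 2p` (separated from `ℚ(-p)`) and
the "weight-`2p`" part `J^p(Gr^W_{2p}B)_ℚ = Gr_ℂ/(F^p + Gr_ℚ)` (of type `ℂ/ℚ`). This file makes the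
dévissage precise by applying the six-term sequence of the connecting homomorphism
(`MixedHodgeExtensionWeakMotifNonSeparated`) to Carlson's weight extension
`G = (0 → W_{2p-1}B → B → B/W_{2p-1}B → 0)` (`weightExtension B (2p-1)`,
`MixedHodgeExtensionSubQuotient`): the sequence

  `0 → Hdgᵖ(B) → Hdgᵖ(B/W_{2p-1}B) —δ→ J⁰_W(W_{2p-1}B(p)) → J⁰_W(B(p)) → J⁰_W((B/W_{2p-1}B)(p)) → 0`

is exact (`Hdgᵖ(W_{2p-1}B) = 0`), where `J⁰_W(W_{2p-1}B(p)) ≅ J^p(W_{2p-1}B)_ℚ` (the pair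
`(ℚ(-p), W_{2p-1}B)` is separated) and `J⁰_W((B/W_{2p-1}B)(p)) ≅ J⁰_W(W_{2p}(B/W_{2p-1}B)(p))
≅ J^p(Gr^W_{2p}B)_ℚ` with `Gr^W_{2p}B = W_{2p}(B/W_{2p-1}B)` pure of weight `2p`; `δ(v)` is the
obstruction to lifting the Hodge class `v` of `Gr^W_{2p}B ⊆ B/W_{2p-1}B` to a Hodge class of `B`, i.e.
the class of `v^*G` in the intermediate Jacobian.

## Main results (all proved; no named facts)

* `hodgeClasses_eq_bot_of_W_eq_top`, `hodgeClasses_weight_eq_bot`,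
  `mkQ_injective_on_hodgeClasses` (`Hdgᵖ(B) ↪ Hdgᵖ(B/W_{2p-1}B)`).
* `weightObstruction B p = δ`, `weightObstruction_apply_eq_zero_iff`, `existsUnique_hodgeClass_lift`,
  `jacobianWMap_subtype_eq_zero_iff`, `jacobianWMap_mkQ_eq_zero_iff`, `jacobianWMap_mkQ_surjective`,
  `injective_jacobianWMap_subtype_iff`, `injective_jacobianWMap_subtype_of_hodgeClasses_eq_bot`.
* Comparisons: `jacobianWTwistToJacobianRat_weight_bijective` (`J⁰_W(W_{2p-1}B(p)) ≅ J^p(W_{2p-1}B)_ℚ`),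
  `weight_quotient_W_two_mul`, `jacobianWTwistToJacobianRat_grTop_bijective`
  (`J⁰_W(W_{2p}(B/W_{2p-1}B)(p)) ≅ J^p(W_{2p}(B/W_{2p-1}B))_ℚ`), `isPure_weight_quotient`.

## References

* [Jannsen1990MixedMotives] U. Jannsen, Mixed Motives and Algebraic K-Theory, LNM 1400 (1990), §9
  Lemma 9.2 and its proof (9.2.3) (galaxy `panama:518548581515341`, pp. 89–90).
* [Carlson1980] J. A. Carlson, Extensions of mixed Hodge structures (1980), §2(b), §2(c) Prop. 3,
  §2(e) Lemma 5 (held text `book:beauvillend-proceedings-indo-french-conference-geometry`, pp. 89–93).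
* [MacLane1963Homology] S. Mac Lane, Homology (1963), Ch. III Thm. 3.4.
-/

open scoped TensorProduct

noncomputable section

namespace Literature.AlgebraicGeometry.Motives

namespace MixedHodgeStructure

open HodgeStructure (ofRat ofRat_apply tate)

universe v

variable {VB : Type v} [AddCommGroup VB] [Module ℚ VB]

/-! ### §1 Hodge classes and the weight filtration -/

section HodgeClasses

variable (H : MixedHodgeStructure VB) (p : ℤ)

/-- **An MHS of weights `< 2p` has no Hodge classes of type `(p, p)`**: `W_mH = H`, `m < 2p` ⇒
`Hdgᵖ(H) = 0` (Carlson's Lemma 5 over `ℚ`: `H_ℚ ∩ F^pH_ℂ = 0`). [cite: Carlson1980, §2(e) Lemma 5] -/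
theorem hodgeClasses_eq_bot_of_W_eq_top {m : ℤ} (hm : H.W m = ⊤) (hmp : m < 2 * p) :
    H.hodgeClasses p = ⊥ := by
  rw [eq_bot_iff]
  intro v hv
  rw [Submodule.mem_bot]
  exact eq_zero_of_ofRat_mem_F H hm hmp ((H.mem_hodgeClasses_iff p v).1 hv).2

/-- `Hdgᵖ(W_mB) = 0` for `m < 2p`. [cite: Carlson1980, §2(e) Lemma 5] -/
theorem hodgeClasses_weight_eq_bot {m : ℤ} (hmp : m < 2 * p) :
    (SubMixedHodgeStructure.weight H m).toMixedHodgeStructure.hodgeClasses p = ⊥ :=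
  hodgeClasses_eq_bot_of_W_eq_top _ p (H.weight_toMixedHodgeStructure_W_self m) hmp

/-- **`Hdgᵖ(B) → Hdgᵖ(B/W_{2p-1}B)` is injective**: a Hodge class killed by `B → B/W_{2p-1}B` lies in
`W_{2p-1}B`, hence is `0` (the tree's `eq_zero_of_mem_hodgeClasses_of_mem_W`). [cite: Carlson1980, §2(e) Lemma 5] -/
theorem mkQ_injective_on_hodgeClasses {v : VB} (hv : v ∈ H.hodgeClasses p)
    (h0 : (SubMixedHodgeStructure.weight H (2 * p - 1)).mkQ.toLinearMap v = 0) : v = 0 := by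
  refine H.eq_zero_of_mem_hodgeClasses_of_mem_W hv ?_
  have h : v ∈ LinearMap.ker (SubMixedHodgeStructure.weight H (2 * p - 1)).mkQ.toLinearMap := h0
  change v ∈ LinearMap.ker (H.W (2 * p - 1)).mkQ at h
  rwa [Submodule.ker_mkQ] at h

end HodgeClasses

/-! ### §2 The dévissage sequence -/

section Devissage

variable (B : MixedHodgeStructure VB) (p : ℤ)

/-- **The weight obstruction `δ_B : Hdgᵖ(B/W_{2p-1}B) → J⁰_W(W_{2p-1}B(p)) ≅ J^p(W_{2p-1}B)_ℚ`**: the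
connecting homomorphism of the weight extension `0 → W_{2p-1}B → B → B/W_{2p-1}B → 0` — `δ_B(v)` is
the invariant of the pull-back `v^*B` in the (generalized) intermediate Jacobian, the obstruction to
lifting `v` to a Hodge class of `B`. [cite: Jannsen1990MixedMotives, §9 9.0 (9.0.2)] [cite: Carlson1980, §2(c) Prop. 3] -/
def weightObstruction :
    (SubMixedHodgeStructure.weight B (2 * p - 1)).quotient.hodgeClasses p →ₗ[ℚ]
      ((SubMixedHodgeStructure.weight B (2 * p - 1)).toMixedHodgeStructure.tateTwist p).jacobianW :=
  (B.weightExtension (2 * p - 1)).weakMotifW p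

/-- `weightObstruction = δ` of the weight extension (by `rfl`). [cite: Carlson1980, §2(c) Prop. 3] -/
theorem weightObstruction_eq : B.weightObstruction p = (B.weightExtension (2 * p - 1)).weakMotifW p := rfl

/-- **Exactness at `Hdgᵖ(B/W_{2p-1}B)`**: `δ_B(v) = 0` iff `v` is the image of a Hodge class of `B`.
[cite: Jannsen1990MixedMotives, §9 9.0 (9.0.2)] [cite: MacLane1963Homology, Ch. III Thm. 3.4] -/
theorem weightObstruction_apply_eq_zero_iff
    (v : (SubMixedHodgeStructure.weight B (2 * p - 1)).quotient.hodgeClasses p) :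
    B.weightObstruction p v = 0 ↔
      ∃ w ∈ B.hodgeClasses p, (SubMixedHodgeStructure.weight B (2 * p - 1)).mkQ.toLinearMap w = v :=
  (B.weightExtension (2 * p - 1)).weakMotifW_apply_eq_zero_iff p v

/-- **Exactness at `Hdgᵖ(B)` and `Hdgᵖ(B/W_{2p-1}B)` combined**: a class `v` with `δ_B(v) = 0` has a
UNIQUE lift to a Hodge class of `B` (`Hdgᵖ(W_{2p-1}B) = 0`), so `Hdgᵖ(B) ≅ ker δ_B`.
[cite: MacLane1963Homology, Ch. III Thm. 3.4] [cite: Carlson1980, §2(e) Lemma 5] -/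
theorem existsUnique_hodgeClass_lift
    (v : (SubMixedHodgeStructure.weight B (2 * p - 1)).quotient.hodgeClasses p)
    (hv : B.weightObstruction p v = 0) :
    ∃! w : VB, w ∈ B.hodgeClasses p ∧ (SubMixedHodgeStructure.weight B (2 * p - 1)).mkQ.toLinearMap w = v := by
  obtain ⟨w, hw, hwv⟩ := (B.weightObstruction_apply_eq_zero_iff p v).1 hv
  refine ⟨w, ⟨hw, hwv⟩, fun w' ⟨hw', hw'v⟩ => ?_⟩
  rw [← sub_eq_zero]
  refine B.mkQ_injective_on_hodgeClasses p ((B.hodgeClasses p).sub_mem hw' hw) ?_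
  rw [map_sub, hw'v, hwv, sub_self]

/-- `Hdgᵖ(W_{2p-1}B) = 0`: the first term of the six-term sequence of the weight extension vanishes.
[cite: Carlson1980, §2(e) Lemma 5] -/
theorem hodgeClasses_weightExtension_sub_eq_bot :
    (SubMixedHodgeStructure.weight B (2 * p - 1)).toMixedHodgeStructure.hodgeClasses p = ⊥ :=
  B.hodgeClasses_weight_eq_bot p (by omega)

/-- `ι(p)_* δ_B = 0`. [cite: MacLane1963Homology, Ch. III Thm. 3.4] -/
theorem jacobianWMap_subtype_weightObstruction
    (v : (SubMixedHodgeStructure.weight B (2 * p - 1)).quotient.hodgeClasses p) :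
    (((SubMixedHodgeStructure.weight B (2 * p - 1)).subtype).tateTwist p).jacobianWMap
      (B.weightObstruction p v) = 0 :=
  (B.weightExtension (2 * p - 1)).jacobianWMap_inc_weakMotifW p v

/-- **Exactness at `J⁰_W(W_{2p-1}B(p)) ≅ J^p(W_{2p-1}B)_ℚ`**: the kernel of
`ι(p)_* : J⁰_W(W_{2p-1}B(p)) → J⁰_W(B(p))` is the image of `δ_B` — the classes of the pull-backs `v^*B`
of `B` along Hodge classes `v` of `Gr^W_{2p}B ⊆ B/W_{2p-1}B`.
[cite: MacLane1963Homology, Ch. III Thm. 3.4] [cite: Jannsen1990MixedMotives, §9 Lemma 9.2] -/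
theorem jacobianWMap_subtype_eq_zero_iff
    (y : ((SubMixedHodgeStructure.weight B (2 * p - 1)).toMixedHodgeStructure.tateTwist p).jacobianW) :
    (((SubMixedHodgeStructure.weight B (2 * p - 1)).subtype).tateTwist p).jacobianWMap y = 0 ↔
      ∃ v, B.weightObstruction p v = y :=
  (B.weightExtension (2 * p - 1)).jacobianWMap_inc_eq_zero_iff p y

/-- The image of `δ_B` is the kernel of `ι(p)_*` (as submodules). [cite: MacLane1963Homology, Ch. III Thm. 3.4] -/
theorem range_weightObstruction :
    LinearMap.range (B.weightObstruction p) =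
      LinearMap.ker (((SubMixedHodgeStructure.weight B (2 * p - 1)).subtype).tateTwist p).jacobianWMap :=
  (B.weightExtension (2 * p - 1)).range_weakMotifW p

/-- `π(p)_* ι(p)_* = 0`. [cite: MacLane1963Homology, Ch. III Thm. 3.4] -/
theorem jacobianWMap_mkQ_jacobianWMap_subtype
    (y : ((SubMixedHodgeStructure.weight B (2 * p - 1)).toMixedHodgeStructure.tateTwist p).jacobianW) :
    (((SubMixedHodgeStructure.weight B (2 * p - 1)).mkQ).tateTwist p).jacobianWMap
      ((((SubMixedHodgeStructure.weight B (2 * p - 1)).subtype).tateTwist p).jacobianWMap y) = 0 :=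
  (B.weightExtension (2 * p - 1)).jacobianWMap_proj_jacobianWMap_inc p y

/-- **Exactness at `J⁰_W(B(p))`**: the kernel of `π(p)_* : J⁰_W(B(p)) → J⁰_W((B/W_{2p-1}B)(p))` is the
image of `ι(p)_* : J⁰_W(W_{2p-1}B(p)) → J⁰_W(B(p))`.
[cite: MacLane1963Homology, Ch. III Thm. 3.4] [cite: Jannsen1990MixedMotives, §9 Lemma 9.2] -/
theorem jacobianWMap_mkQ_eq_zero_iff (z : (B.tateTwist p).jacobianW) :
    (((SubMixedHodgeStructure.weight B (2 * p - 1)).mkQ).tateTwist p).jacobianWMap z = 0 ↔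
      ∃ y, (((SubMixedHodgeStructure.weight B (2 * p - 1)).subtype).tateTwist p).jacobianWMap y = z :=
  (B.weightExtension (2 * p - 1)).jacobianWMap_proj_eq_zero_iff p z

/-- The image of `ι(p)_*` is the kernel of `π(p)_*` (as submodules). [cite: MacLane1963Homology, Ch. III Thm. 3.4] -/
theorem range_jacobianWMap_subtype :
    LinearMap.range (((SubMixedHodgeStructure.weight B (2 * p - 1)).subtype).tateTwist p).jacobianWMap =
      LinearMap.ker (((SubMixedHodgeStructure.weight B (2 * p - 1)).mkQ).tateTwist p).jacobianWMap :=
  (B.weightExtension (2 * p - 1)).range_jacobianWMap_inc p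

/-- **Right end: `π(p)_* : J⁰_W(B(p)) → J⁰_W((B/W_{2p-1}B)(p))` is onto.**
[cite: MacLane1963Homology, Ch. III Thm. 3.4] [cite: Jannsen1990MixedMotives, §9 Lemma 9.2] -/
theorem jacobianWMap_mkQ_surjective :
    Function.Surjective (((SubMixedHodgeStructure.weight B (2 * p - 1)).mkQ).tateTwist p).jacobianWMap :=
  (B.weightExtension (2 * p - 1)).jacobianWMap_proj_surjective p

/-- **`J^p(W_{2p-1}B)_ℚ → J⁰_W(B(p))` is injective iff every Hodge class of `B/W_{2p-1}B` (i.e. of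
`Gr^W_{2p}B`) lifts to a Hodge class of `B`.** [cite: MacLane1963Homology, Ch. III Thm. 3.4] -/
theorem injective_jacobianWMap_subtype_iff :
    Function.Injective (((SubMixedHodgeStructure.weight B (2 * p - 1)).subtype).tateTwist p).jacobianWMap ↔
      ∀ v ∈ (SubMixedHodgeStructure.weight B (2 * p - 1)).quotient.hodgeClasses p,
        ∃ w ∈ B.hodgeClasses p, (SubMixedHodgeStructure.weight B (2 * p - 1)).mkQ.toLinearMap w = v :=
  (B.weightExtension (2 * p - 1)).injective_jacobianWMap_inc_iff p

/-- If `Gr^W_{2p}B` carries no Hodge classes (`Hdgᵖ(B/W_{2p-1}B) = 0`), the intermediate-Jacobian part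
injects: `0 → J^p(W_{2p-1}B)_ℚ → J⁰_W(B(p)) → J⁰_W((B/W_{2p-1}B)(p)) → 0` is short exact.
[cite: MacLane1963Homology, Ch. III Thm. 3.4] -/
theorem injective_jacobianWMap_subtype_of_hodgeClasses_eq_bot
    (h : (SubMixedHodgeStructure.weight B (2 * p - 1)).quotient.hodgeClasses p = ⊥) :
    Function.Injective (((SubMixedHodgeStructure.weight B (2 * p - 1)).subtype).tateTwist p).jacobianWMap := by
  rw [injective_jacobianWMap_subtype_iff]
  intro v hv
  rw [h, Submodule.mem_bot] at hv
  exact ⟨0, Submodule.zero_mem _, by rw [hv, map_zero]⟩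

end Devissage

/-! ### §3 Identification of the outer terms -/

section OuterTerms

variable (B : MixedHodgeStructure VB) (p : ℤ)

/-- `W_{2p}(W_{2p-1}B) = W_{2p-1}B` (everything). [cite: Carlson1980, §2(b)] -/
theorem weight_toMixedHodgeStructure_W_two_mul :
    (SubMixedHodgeStructure.weight B (2 * p - 1)).toMixedHodgeStructure.W (2 * p) = ⊤ :=
  eq_top_iff.2 ((B.weight_toMixedHodgeStructure_W_self (2 * p - 1)).symm.le.trans
    ((SubMixedHodgeStructure.weight B (2 * p - 1)).toMixedHodgeStructure.monotone_W (by omega)))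

/-- **The left outer term is a generalized intermediate Jacobian**: for `W_{2p-1}B` (weights `< 2p`,
separated from `ℚ(-p)`) the comparison `J⁰_W(W_{2p-1}B(p)) → J^p(W_{2p-1}B)_ℚ = (W_{2p-1}B)_ℂ/(F^p + ℚ)`
is bijective. [cite: Carlson1980, §2(b) Prop. 2] -/
theorem jacobianWTwistToJacobianRat_weight_bijective :
    Function.Bijective
      (jacobianWTwistToJacobianRat (SubMixedHodgeStructure.weight B (2 * p - 1)).toMixedHodgeStructure p) :=
  jacobianWTwistToJacobianRat_bijective _ p (B.weight_toMixedHodgeStructure_W_two_mul p)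

/-- `W_{2p-1}(B/W_{2p-1}B) = 0`. [cite: Carlson1980, §2(b)] -/
theorem weight_quotient_W_pred : (SubMixedHodgeStructure.weight B (2 * p - 1)).quotient.W (2 * p - 1) = ⊥ :=
  B.weight_quotient_W_self (2 * p - 1)

/-- **`Gr^W_{2p}B = W_{2p}(B/W_{2p-1}B)` is pure of weight `2p`**: `W_{2p-1} = 0` and `W_{2p} =`
everything on the sub-MHS `W_{2p}(B/W_{2p-1}B)`. [cite: Carlson1980, §2(b)] -/
theorem weight_quotient_weight_W :
    (SubMixedHodgeStructure.weight (SubMixedHodgeStructure.weight B (2 * p - 1)).quotient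
        (2 * p)).toMixedHodgeStructure.W (2 * p - 1) = ⊥ ∧
      (SubMixedHodgeStructure.weight (SubMixedHodgeStructure.weight B (2 * p - 1)).quotient
        (2 * p)).toMixedHodgeStructure.W (2 * p) = ⊤ := by
  refine ⟨?_, weight_toMixedHodgeStructure_W_self _ _⟩
  rw [eq_bot_iff]
  intro x hx
  have hx' : (x : VB ⧸ (SubMixedHodgeStructure.weight B (2 * p - 1)).toSubmodule) ∈
      (SubMixedHodgeStructure.weight B (2 * p - 1)).quotient.W (2 * p - 1) := hx
  rw [B.weight_quotient_W_pred p, Submodule.mem_bot] at hx'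
  rw [Submodule.mem_bot]
  exact Subtype.ext hx'

/-- **The right outer term**: `J⁰_W((B/W_{2p-1}B)(p)) ≅ J⁰_W(W_{2p}(B/W_{2p-1}B)(p))` (Jannsen's
reduction, `jacobianWWeightEquiv`) and the comparison
`J⁰_W(W_{2p}(B/W_{2p-1}B)(p)) → J^p(Gr^W_{2p}B)_ℚ = Gr_ℂ/(F^p Gr_ℂ + Gr_ℚ)` is bijective (`Gr` pure of
weight `2p`). [cite: Jannsen1990MixedMotives, §9 Lemma 9.2] -/
theorem jacobianWTwistToJacobianRat_grTop_bijective :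
    Function.Bijective
      (jacobianWTwistToJacobianRat
        (SubMixedHodgeStructure.weight (SubMixedHodgeStructure.weight B (2 * p - 1)).quotient
          (2 * p)).toMixedHodgeStructure p) :=
  jacobianWTwistToJacobianRat_bijective _ p (B.weight_quotient_weight_W p).2

/-- The composite identification of the right outer term,
`J⁰_W((B/W_{2p-1}B)(p)) ≃ J^p(W_{2p}(B/W_{2p-1}B))_ℚ = J^p(Gr^W_{2p}B)_ℚ`, as a linear equivalence.
[cite: Jannsen1990MixedMotives, §9 Lemma 9.2] -/
def jacobianWQuotientEquivJacobianRatGr :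
    ((SubMixedHodgeStructure.weight B (2 * p - 1)).quotient.tateTwist p).jacobianW ≃ₗ[ℚ]
      (SubMixedHodgeStructure.weight (SubMixedHodgeStructure.weight B (2 * p - 1)).quotient
          (2 * p)).toMixedHodgeStructure.jacobianRat p :=
  (jacobianWWeightEquiv (SubMixedHodgeStructure.weight B (2 * p - 1)).quotient p).symm.trans
    (LinearEquiv.ofBijective _ (B.jacobianWTwistToJacobianRat_grTop_bijective p))

/-- The composite identification of the left outer term, `J⁰_W(W_{2p-1}B(p)) ≃ J^p(W_{2p-1}B)_ℚ`, as a
linear equivalence. [cite: Carlson1980, §2(b) Prop. 2] -/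
def jacobianWWeightPredEquivJacobianRat :
    ((SubMixedHodgeStructure.weight B (2 * p - 1)).toMixedHodgeStructure.tateTwist p).jacobianW ≃ₗ[ℚ]
      (SubMixedHodgeStructure.weight B (2 * p - 1)).toMixedHodgeStructure.jacobianRat p :=
  LinearEquiv.ofBijective _ (B.jacobianWTwistToJacobianRat_weight_bijective p)

/-- **When `B` has no weight-`2p` part (`W_{2p}B = W_{2p-1}B`) the quotient term vanishes**:
`J⁰_W((B/W_{2p-1}B)(p)) = 0`, so `ι(p)_* : J^p(W_{2p-1}B)_ℚ → J⁰_W(B(p))` is onto (and injective iff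
`Hdgᵖ(B/W_{2p-1}B) = 0`, which then also holds). [cite: Jannsen1990MixedMotives, §9 Lemma 9.2] -/
theorem jacobianW_quotient_eq_zero_of_W_eq (h : B.W (2 * p) = B.W (2 * p - 1))
    (z : ((SubMixedHodgeStructure.weight B (2 * p - 1)).quotient.tateTwist p).jacobianW) : z = 0 := by
  refine jacobianW_tateTwist_eq_zero _ p ?_ z
  rw [SubMixedHodgeStructure.quotient_W, h]
  exact Submodule.mkQ_map_self _

/-- Under `W_{2p}B = W_{2p-1}B`: `ι(p)_* : J⁰_W(W_{2p-1}B(p)) → J⁰_W(B(p))` is surjective.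
[cite: Jannsen1990MixedMotives, §9 Lemma 9.2] -/
theorem jacobianWMap_subtype_surjective_of_W_eq (h : B.W (2 * p) = B.W (2 * p - 1)) :
    Function.Surjective (((SubMixedHodgeStructure.weight B (2 * p - 1)).subtype).tateTwist p).jacobianWMap := by
  intro z
  exact (B.jacobianWMap_mkQ_eq_zero_iff p z).1 (B.jacobianW_quotient_eq_zero_of_W_eq p h _)

/-- Under `W_{2p}B = W_{2p-1}B` the quotient has no Hodge classes of type `(p, p)` either
(`Hdgᵖ ⊆ W_{2p} = 0`), so `ι(p)_*` is also injective: `J^p(W_{2p-1}B)_ℚ ≅ J⁰_W(B(p))`.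
[cite: Jannsen1990MixedMotives, §9 Lemma 9.2] -/
theorem jacobianWMap_subtype_bijective_of_W_eq (h : B.W (2 * p) = B.W (2 * p - 1)) :
    Function.Bijective (((SubMixedHodgeStructure.weight B (2 * p - 1)).subtype).tateTwist p).jacobianWMap := by
  refine ⟨B.injective_jacobianWMap_subtype_of_hodgeClasses_eq_bot p ?_, B.jacobianWMap_subtype_surjective_of_W_eq p h⟩
  rw [eq_bot_iff]
  intro v hv
  have hW : v ∈ (SubMixedHodgeStructure.weight B (2 * p - 1)).quotient.W (2 * p) :=
    (SubMixedHodgeStructure.weight B (2 * p - 1)).quotient.hodgeClasses_le_W p hv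
  rw [SubMixedHodgeStructure.quotient_W, h] at hW
  change v ∈ (B.W (2 * p - 1)).map (B.W (2 * p - 1)).mkQ at hW
  rw [Submodule.mkQ_map_self] at hW
  exact hW

end OuterTerms

end MixedHodgeStructure

end Literature.AlgebraicGeometry.Motives

end
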